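/- Copyright: ym3-torus cell, WIDTH-5 ATTACH seat `ym-ust-19936-w4` (prover, g10), for crux `HistoryTailL` (stmt-QuantumFields-19936),
level-0 prefactor-free infrastructure: the β-UNIFORM exponential moment ∕ Gaussian plaquette tail of `SU(2)` on (ℤ∕n)³ MODULO the one-site doubling.
Released under the licence of the surrounding project. -/
import Summits.QuantumFields.YangMills.Theorems.LocalInsertionTorusUniformDoublingSU2D3
import Literature.MathematicalPhysics.QuantumFieldTheory.WilsonPlaquetteExpMomentSandwich
import HarnessLib

/-!
# The β-uniform single-plaquette exponential moment of `SU(2)` on the three-torus, modulo the one-site doubling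

Support file (`--supports stmt-QuantumFields-19936 --as helper`): the pay-off of stage (T4) of the cell's level-0 PREFACTOR-FREE plan (LEAD ★w1-19936 g7
00:52:13Z: «(EQ1)-from-(EM) and GOOD-1-from-(GT), γ-uniform form only, after (T4)»).  The door ✓`PlaquetteExpMoment.integral_exp_mul_plaquette_le_of_sandwich`
at `λ = ½` needs `zlow ≤ Z(β)` and `Z(β∕2) ≤ zup`; the uniform doubling ✓`uniformDoubling_su2_d3_of_oneSiteDoubling` (`Z_n(β∕2) ≤ e^{A n³} Z_n(β)`, `n ≥ 2`,
`β ≥ 4`, modulo (T4-ONE)) makes `zup∕zlow = e^{A n³}`, whose `n³`-th root is the β-FREE constant `e^{A}`: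

* ★`exists_integral_exp_half_plaquette_su2_le_of_oneSiteDoubling` — (EM)-uniform: `hONE → ∃ A, ∀ n ≥ 2 even, β ≥ 4, 0 < a, c₀:
  ∫ exp(½·β·(2 − Re tr U_{(c₀;0,a)})) dμ_{Λ,β} ≤ e^{A}` (`ρ = fundamentalRep (Fin 2)` on `GaugeConfig 3 n`);
* ★`exists_measureReal_largePlaquette_su2_le_of_oneSiteDoubling` — (GT)-uniform: same hypotheses, `θ ≥ 0`:
  `μ_{Λ,β}{θ ≤ ‖U_{(c₀;0,a)} − 1‖} ≤ e^{A} · e^{−βθ²∕4}` (door ✓`measureReal_largePlaquette_le_of_sandwich`).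

No power `β^{c∕n}` survives — this is the γ-uniform form of (EM)∕(GT) the LEAD's caveat demanded, CONDITIONAL on the displayed one-site doubling
`hONE : ∃ K, ∀ t > 0, Z₁(t∕4) ≤ K·Z₁(t)` (`Z₁ = partitionFunction (d := 3) (L := 1) (fundamentalRep (Fin 2))`, T4-ONE, NOT proved in the tree).

HONEST SCOPE.  A composition of tree theorems with one displayed hypothesis; nothing of (T4-ONE), of the lines' stubs, of `HistoryTailL` or of any
crux is proved; the T³ reading (`gibbsK`, coupling `β_K∕2`, ✓`T3FinestHeightTail.gibbsMeasure_real_eq_wilsonMeasure_real`) is not restated here.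
YM₃ on T³ is rung R3 — not d = 4, not infinite volume, not a mass gap, not Clay.
-/

namespace Summit.QuantumFields.YangMills.Theorems.LocalInsertion.ExpMomentSU2Uniform

open MeasureTheory
open scoped Matrix.Norms.L2Operator ENNReal
open Literature.MathematicalPhysics.QuantumFieldTheory
open Literature.MathematicalPhysics.QuantumLattice (fundamentalRep continuous_fundamentalRep fundamentalRep_mem_unitaryGroup)
open Summit.QuantumFields.YangMills.Theorems.FemtoCurvatureTwoPoint.PlaquetteVariance (partitionFunction_toReal_pos)
open Summit.QuantumFields.YangMills.Theorems.LocalInsertion.TorusUpperAxisD3 (OneSiteD3.partitionFunction_eq_lintegral')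
open Summit.QuantumFields.YangMills.Theorems.LocalInsertion.TorusUniformDoublingSU2D3 (uniformDoubling_su2_d3_of_oneSiteDoubling)

noncomputable section

/-- **The sandwich inputs at `λ = ½` from the uniform doubling**: for `n ≥ 2`, `β ≥ 4` and `Z_n(β∕2) ≤ e^{A n³}·Z_n(β)`, with `zlow := Z_n(β)`,
`zup := e^{A n³}·Z_n(β)`: `0 < zlow`, `ofReal zlow ≤ ∫⁻ e^{−βS} dπ`, `∫⁻ e^{−(1−½)βS} dπ ≤ ofReal zup`, and `(zup∕zlow)^{1∕n³} = e^{A}`. [folklore] -/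
theorem sandwich_inputs_of_doubling {n : ℕ} [NeZero n] (hn : 2 ≤ n) {β A : ℝ}
    (hdbl : (partitionFunction (d := 3) (L := n) (fundamentalRep (Fin 2)) (β / 2)).toReal ≤
      Real.exp (A * (n : ℝ) ^ 3) * (partitionFunction (d := 3) (L := n) (fundamentalRep (Fin 2)) β).toReal) :
    0 < (partitionFunction (d := 3) (L := n) (fundamentalRep (Fin 2)) β).toReal ∧
    ENNReal.ofReal (partitionFunction (d := 3) (L := n) (fundamentalRep (Fin 2)) β).toReal ≤
      ∫⁻ U, ENNReal.ofReal (Real.exp (-β * wilsonAction (fundamentalRep (Fin 2)) U))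
        ∂(Measure.pi fun _ : Edge 3 n => haarProbability (Matrix.specialUnitaryGroup (Fin 2) ℂ)) ∧
    ∫⁻ U, ENNReal.ofReal (Real.exp (-((1 - 1 / 2) * β) * wilsonAction (fundamentalRep (Fin 2)) U))
        ∂(Measure.pi fun _ : Edge 3 n => haarProbability (Matrix.specialUnitaryGroup (Fin 2) ℂ)) ≤
      ENNReal.ofReal (Real.exp (A * (n : ℝ) ^ 3) *
        (partitionFunction (d := 3) (L := n) (fundamentalRep (Fin 2)) β).toReal) ∧
    (Real.exp (A * (n : ℝ) ^ 3) * (partitionFunction (d := 3) (L := n) (fundamentalRep (Fin 2)) β).toReal /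
        (partitionFunction (d := 3) (L := n) (fundamentalRep (Fin 2)) β).toReal) ^ ((1 : ℝ) / (n : ℝ) ^ 3) =
      Real.exp A := by
  haveI := Literature.Barriers.QuantumFields.secondCountableTopology_su 2
  have hρc := continuous_fundamentalRep (Fin 2)
  have hZ := partitionFunction_toReal_pos (d := 3) (L := n) (fundamentalRep (Fin 2)) hρc β
  have hZh := partitionFunction_toReal_pos (d := 3) (L := n) (fundamentalRep (Fin 2)) hρc (β / 2)
  have hZhtop : partitionFunction (d := 3) (L := n) (fundamentalRep (Fin 2)) (β / 2) ≠ ⊤ :=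
    (ENNReal.toReal_pos_iff.1 hZh).2.ne
  have hn0 : (0 : ℝ) < (n : ℝ) ^ 3 := by
    have : (0 : ℝ) < n := by exact_mod_cast (show 0 < n by omega)
    positivity
  refine ⟨hZ, ?_, ?_, ?_⟩
  · rw [← OneSiteD3.partitionFunction_eq_lintegral']
    exact ENNReal.ofReal_toReal_le
  · rw [show (1 - 1 / 2) * β = β / 2 by ring, ← OneSiteD3.partitionFunction_eq_lintegral',
      ← ENNReal.ofReal_toReal hZhtop]
    exact ENNReal.ofReal_le_ofReal hdbl
  · rw [mul_div_cancel_right₀ _ hZ.ne', ← Real.exp_mul]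
    congr 1
    field_simp

/-- ★ **THE β-UNIFORM SINGLE-PLAQUETTE EXPONENTIAL MOMENT OF `SU(2)` ON `(ℤ∕n)³`, MODULO THE ONE-SITE DOUBLING** ((EM)-uniform): if
`Z₁(t∕4) ≤ K·Z₁(t)` for all `t > 0`, there is `A` with, for all even `n ≥ 2`, `β ≥ 4`, directions `0 < a` and sites `c₀`,
`∫ exp(½·β·(2 − Re tr U_{(c₀;0,a)})) dμ_{Λ,β} ≤ e^{A}` — no power of `β`, no power of the volume.
[cite: FrohlichIsraelLiebSimon1978, Thm. 4.1; arXiv160201222, §11] -/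
theorem exists_integral_exp_half_plaquette_su2_le_of_oneSiteDoubling
    (hONE : ∃ K : ℝ, ∀ t : ℝ, 0 < t →
      (partitionFunction (d := 3) (L := 1) (fundamentalRep (Fin 2)) (t / 4)).toReal ≤
        K * (partitionFunction (d := 3) (L := 1) (fundamentalRep (Fin 2)) t).toReal) :
    ∃ A : ℝ, ∀ (n : ℕ) [NeZero n] (β : ℝ), 2 ≤ n → Even n → 4 ≤ β →
      ∀ {a : Fin 3}, (0 : Fin 3) < a → ∀ c₀ : Site 3 n,
        ∫ U, Real.exp (1 / 2 * β * (((2 : ℕ) : ℝ) -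
            ((fundamentalRep (Fin 2)) (plaquetteHolonomy U c₀ 0 a)).trace.re))
          ∂(wilsonMeasure (fundamentalRep (Fin 2)) β) ≤ Real.exp A := by
  haveI := Literature.Barriers.QuantumFields.secondCountableTopology_su 2
  obtain ⟨A, hA⟩ := uniformDoubling_su2_d3_of_oneSiteDoubling hONE
  refine ⟨A, fun n _ β hn hne hβ a ha c₀ => ?_⟩
  obtain ⟨hZ, hlow, hup, hroot⟩ := sandwich_inputs_of_doubling hn (hA n β hn hβ)
  rw [← hroot]
  exact PlaquetteExpMoment.integral_exp_mul_plaquette_le_of_sandwich (d := 3) (L := n) (fundamentalRep (Fin 2))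
    fundamentalRep_mem_unitaryGroup hne (continuous_fundamentalRep (Fin 2)) (by linarith) ha (by norm_num) hZ
    (by positivity) hlow hup c₀

/-- ★ **THE β-UNIFORM GAUSSIAN PLAQUETTE TAIL OF `SU(2)` ON `(ℤ∕n)³`, MODULO THE ONE-SITE DOUBLING** ((GT)-uniform): under the same
hypothesis there is `A` with, for all even `n ≥ 2`, `β ≥ 4`, `0 < a`, `c₀` and `θ ≥ 0`,
`μ_{Λ,β}{θ ≤ ‖U_{(c₀;0,a)} − 1‖} ≤ e^{A} · e^{−(½β)θ²∕2}` (`= e^{A}·e^{−βθ²∕4}`). [cite: FrohlichIsraelLiebSimon1978, Thm. 4.1; arXiv160201222, §11] -/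
theorem exists_measureReal_largePlaquette_su2_le_of_oneSiteDoubling
    (hONE : ∃ K : ℝ, ∀ t : ℝ, 0 < t →
      (partitionFunction (d := 3) (L := 1) (fundamentalRep (Fin 2)) (t / 4)).toReal ≤
        K * (partitionFunction (d := 3) (L := 1) (fundamentalRep (Fin 2)) t).toReal) :
    ∃ A : ℝ, ∀ (n : ℕ) [NeZero n] (β : ℝ), 2 ≤ n → Even n → 4 ≤ β →
      ∀ {a : Fin 3}, (0 : Fin 3) < a → ∀ (c₀ : Site 3 n) {θ : ℝ}, 0 ≤ θ →
        (wilsonMeasure (fundamentalRep (Fin 2)) β).real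
            {U : GaugeConfig 3 n (Matrix.specialUnitaryGroup (Fin 2) ℂ) |
              θ ≤ ‖(fundamentalRep (Fin 2)) (plaquetteHolonomy U c₀ 0 a) - 1‖} ≤
          Real.exp A * Real.exp (-(1 / 2 * β * θ ^ 2 / 2)) := by
  haveI := Literature.Barriers.QuantumFields.secondCountableTopology_su 2
  obtain ⟨A, hA⟩ := uniformDoubling_su2_d3_of_oneSiteDoubling hONE
  refine ⟨A, fun n _ β hn hne hβ a ha c₀ θ hθ => ?_⟩
  obtain ⟨hZ, hlow, hup, hroot⟩ := sandwich_inputs_of_doubling hn (hA n β hn hβ)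
  rw [← hroot]
  exact PlaquetteExpMoment.measureReal_largePlaquette_le_of_sandwich (d := 3) (L := n) (fundamentalRep (Fin 2))
    fundamentalRep_mem_unitaryGroup hne (continuous_fundamentalRep (Fin 2)) (by linarith) ha (by norm_num) hZ
    (by positivity) hlow hup c₀ hθ

end

end Summit.QuantumFields.YangMills.Theorems.LocalInsertion.ExpMomentSU2Uniform
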